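import Summits.RiemannHypothesis.RiemannHypothesis.Theorems.TiltedLandingLaw421R3BudgetBoxReal

/-!
# K-2 budget, THE PERTURBATIVE BOX REDUCED TO A GEOMETRIC CELL COVER (C1 g36, W-08 ⟨33346⟩; instr-1 E7 pin `κH 3.9000` / cut proposal T-R56)

With images J/K/L tree (#1203/#1206/#1207), `GeometricBudget 10 μ₀` (`μ₀ ≤ 1/2`) follows from its restriction to the PERTURBATIVE BOX `t_v < 3/2 ∧ t_z < 5`
(`geometricBudget_ten_of_box`).  This file (PART 2; the cell criterion `CellOK` and the seven REAL CORES it sums are PART 1 =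
`…R3BudgetBoxReal`) discharges the box ANALYTICALLY down to a statement about the PAIR GEOMETRY ALONE: at a point `(v, z)` of the
touch region, five CELL CONSTANTS `S₀ ≤ T_v + T_z − 3` (zeroth-order slack, `T_w := 1 − 2·Im w·pairPull w ·`), `T_z ≤ T₁`, `Im v·‖E_z − E_v‖ ≤ e₁`
(`E_w` = `pairExplicit`), `‖z − v‖ ≤ r₁·Im z`, `β₀·Im v ≤ Im z` satisfying the linear-quadratic CELL CRITERION
`CellOK`: `13/50 + (181/50)μ₀ + 2T₁P₁ + (361/100)μ₀/β₀ + (3/200)T₁²/β₀² + 1/1000 ≤ (749/25)S₀ + (499/50)(1 + μ₀)`, `P₁ := e₁ + μ₀r₁`,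
force the budget conclusion at that point (`budget_box_cell`, the ONE-SHOT CRUDE-NORM architecture: both Newton discs by `energy_drop_closedDisc`, the
z-weight `κ²/‖K_z‖²` through `Im v·‖K_z − K_v‖ ≤ P₁` pointwise — no sign case, no Re/Im split, no corner/bulk split at the analytic level; at the corner
`(β, d) = (1, ±2)`: `S₀ = 0`, `T₁ = 3/2`, `P₁ = 5/2`, margin `3.56`).  Hence **`CellCover μ₀ → GeometricBudget 10 μ₀`** (`geometricBudget_ten_of_cellCover`) and
**`CellCover (1/2) → PerturbativeDropLightPairQ 10 (1/2)`** (= K-2; `k2_of_cellCover`), where `CellCover μ₀` is the purely geometric, scale-invariant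
statement that every admissible pair carries such constants — the object instr-1's cut T-R56 / T-R71 is a certificate FOR (one rectangle lemma + a finite
`norm_num` table away; not in this file).
STATUS: support; `CellCover (1/2)`, `GeometricBudget 10 (1/2)` and K-2 are NOT proved here.  Nothing here bears on the truth of RH; RH is not proved;
33346 / 33347 OPEN. -/

namespace RhW08.BudgetBox

open Complex
open scoped ComplexConjugate
open RhW08.UncoveredSign (pairPull)
open RhW08.LightPairDrop (GeometricBudget perturbativeDropLightPairQ_ten_half im_explicit im_mul_norm_ge)
open RhW08.PerturbativeRung2 (PerturbativeDropLightPairQ)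
open RhW08.BudgetAlgebra (energy_drop_closedDisc normSq_tilt_t pairExplicit)
open RhW08.LightIsolatedChild (im_newtonPoint)
open RhW08.BudgetCornerSplit (GeometricBudgetOn)
open RhW08.BudgetCaseB1 (pairPull_le_of_sep geometricBudget_ten_of_box)

/-! ## §4 Geometry of the pair: the upper pull is negative (the lower one is `≤ 2/Im v`: `pairPull_le_of_sep`, tree #1207) -/

/-- §4 the pull at the UPPER state is negative: `0 < Im v < Im z` ⇒ `pairPull z v < 0` (so `T_z > 1` and `t_z > 1/2`). -/
theorem pairPull_upper_neg {v z : ℂ} (hv : 0 < v.im) (hvz : v.im < z.im) : pairPull z v < 0 := by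
  have hne : z ≠ v := fun e => by rw [e] at hvz; exact lt_irrefl _ hvz
  have hN1 : 0 < Complex.normSq (z - v) := Complex.normSq_pos.mpr (sub_ne_zero.mpr hne)
  have hN2 : 0 < Complex.normSq (z - conj v) := by
    rw [Complex.normSq_apply]; simp only [sub_re, sub_im, conj_re, conj_im]; nlinarith
  have h1 : (v.im - z.im) / Complex.normSq (z - v) < 0 := div_neg_of_neg_of_pos (by linarith) hN1
  have h2 : 0 < (v.im + z.im) / Complex.normSq (z - conj v) := div_pos (by linarith) hN2
  have e : pairPull z v = (v.im - z.im) / Complex.normSq (z - v) - (v.im + z.im) / Complex.normSq (z - conj v) := rfl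
  linarith

/-! ## §5 The box on one cell: v-part, currencies, z-part, assembly -/

/-- §5 (currencies of the lower state) `k = Im v·κ ≥ 30`, `L = Im v·‖K_v‖`, `t = −Im v·Im K_v ∈ [T_v/2, 3/2]`, `T_v ≥ −3` ⇒
`L ≥ 29.96`, `L² ≤ k² + 5/4`, `k² ≤ L² + 7/4`, `499k ≤ 500L`, and `T_v/2 ≤ t`, `L² = k² + t − 1/4`. -/
theorem currencies {v z Rv Kv : ℂ} (hv : 0 < v.im) (hvz : v.im < z.im) (hsep : v.im ≤ 2 * ‖v - z‖)
    (hKv : Kv = (v - conj v)⁻¹ + (v - z)⁻¹ + (v - conj z)⁻¹ + Rv) (hRv : Rv.im ≤ 0)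
    (hflv : 30 ≤ v.im * ‖Kv + I / (2 * (v.im : ℂ))‖) (hbv : -(v.im * Kv.im) < 3 / 2) :
    2996 / 100 ≤ v.im * ‖Kv‖ ∧ (v.im * ‖Kv‖) ^ 2 ≤ (v.im * ‖Kv + I / (2 * (v.im : ℂ))‖) ^ 2 + 5 / 4 ∧
      (v.im * ‖Kv + I / (2 * (v.im : ℂ))‖) ^ 2 ≤ (v.im * ‖Kv‖) ^ 2 + 7 / 4 ∧
      499 * (v.im * ‖Kv + I / (2 * (v.im : ℂ))‖) ≤ 500 * (v.im * ‖Kv‖) ∧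
      (1 - 2 * v.im * pairPull v z) / 2 ≤ -(v.im * Kv.im) ∧
      (v.im * ‖Kv‖) ^ 2 = (v.im * ‖Kv + I / (2 * (v.im : ℂ))‖) ^ 2 + (-(v.im * Kv.im)) - 1 / 4 := by
  set a := v.im with ha
  set κ := ‖Kv + I / (2 * (a : ℂ))‖ with hκ
  set n := ‖Kv‖ with hn
  set t := -(a * Kv.im) with htdef
  have hk : 30 ≤ a * κ := hflv
  have hLk : a * κ - 1 / 2 ≤ a * n := im_mul_norm_ge hv
  have hκ2 : κ ^ 2 = n ^ 2 - (t - 1 / 4) / a ^ 2 := normSq_tilt_t Kv hv.ne'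
  have hkL : (a * n) ^ 2 = (a * κ) ^ 2 + t - 1 / 4 := by
    rw [mul_pow, mul_pow, hκ2]; field_simp; ring
  have hKvim : Kv.im = -(1 / (2 * a)) + pairPull v z + Rv.im := by rw [hKv, add_im, im_explicit]
  have htTv : (1 - 2 * a * pairPull v z) / 2 ≤ t := by
    have e2 : t = 1 / 2 - a * pairPull v z - a * Rv.im := by rw [htdef, hKvim]; field_simp; ring
    rw [e2]
    have := mul_nonpos_iff.mpr (Or.inl ⟨hv.le, hRv⟩)
    linarith
  have hTv3 : a * pairPull v z ≤ 2 := by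
    have := mul_le_mul_of_nonneg_left (pairPull_le_of_sep hv hvz hsep) hv.le
    rwa [show a * (2 / a) = 2 by field_simp] at this
  have ht1 : -(3 / 2) ≤ t := by linarith
  have ht2 : t ≤ 3 / 2 := hbv.le
  have h900 : (30:ℝ) ^ 2 ≤ (a * κ) ^ 2 := pow_le_pow_left₀ (by norm_num) hk 2
  have hL2 : 898 ≤ (a * n) ^ 2 := by linarith
  have hL0 : 0 < a * n := by linarith
  have hL : 2996 / 100 ≤ a * n := by
    by_contra h
    have h' := pow_lt_pow_left₀ (not_le.mp h) hL0.le two_ne_zero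
    linarith [h']
  refine ⟨hL, by linarith, by linarith, ?_, htTv, hkL⟩
  have hsq : (499 * (a * κ)) ^ 2 ≤ (500 * (a * n)) ^ 2 := by
    have e1 : (499 * (a * κ)) ^ 2 = 249001 * (a * κ) ^ 2 := by ring
    have e2 : (500 * (a * n)) ^ 2 = 250000 * (a * n) ^ 2 := by ring
    rw [e1, e2]; linarith
  exact (pow_le_pow_iff_left₀ (by linarith) (by linarith) two_ne_zero).mp hsq

set_option maxHeartbeats 400000 in
/-- §5 (v-part) the lower Newton disc in the box: `T_v − (13/50 + (181/50)μ₀)/(Im v‖K_v‖) ≤ (Im v² − Im u₁²)·κ²`. -/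
theorem v_part {v z Rv Kv u₁ : ℂ} {μ₀ : ℝ} (hμ0 : 0 ≤ μ₀) (hμ : μ₀ ≤ 1 / 2)
    (hv : 0 < v.im) (hvz : v.im < z.im) (hsep : v.im ≤ 2 * ‖v - z‖)
    (hKv : Kv = (v - conj v)⁻¹ + (v - z)⁻¹ + (v - conj z)⁻¹ + Rv) (hRv : Rv.im ≤ 0)
    (hflv : 30 ≤ v.im * ‖Kv + I / (2 * (v.im : ℂ))‖)
    (hd₁ : ‖u₁ - (v - Kv⁻¹)‖ ≤ (9 / 5) * (μ₀ / (v.im * ‖Kv‖) ^ 2) / ‖Kv‖) (hbv : -(v.im * Kv.im) < 3 / 2) :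
    (1 - 2 * v.im * pairPull v z) - (13 / 50 + (181 / 50) * μ₀) / (v.im * ‖Kv‖) ≤
      (v.im ^ 2 - u₁.im ^ 2) * ‖Kv + I / (2 * (v.im : ℂ))‖ ^ 2 := by
  obtain ⟨hL, -, -, -, htTv, hkL⟩ := currencies hv hvz hsep hKv hRv hflv hbv
  set a := v.im with ha
  set κ := ‖Kv + I / (2 * (a : ℂ))‖ with hκ
  set n := ‖Kv‖ with hn
  set t := -(a * Kv.im) with htdef
  set Tv := 1 - 2 * a * pairPull v z with hTvdef
  have hk : 30 ≤ a * κ := hflv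
  have hL0 : 0 < a * n := by linarith
  have hn0 : 0 < n := pos_of_mul_pos_right hL0 hv.le
  have hTv3 : -3 ≤ Tv := by
    have := mul_le_mul_of_nonneg_left (pairPull_le_of_sep hv hvz hsep) hv.le
    rw [show a * (2 / a) = 2 by field_simp] at this
    rw [hTvdef]; linarith
  have ht1 : -(3 / 2) ≤ t := by linarith
  have ht2 : t ≤ 3 / 2 := hbv.le
  -- the centre height
  have hcv : |(v - Kv⁻¹).im| ≤ a * (1 + 3 / (2 * (a * n) ^ 2)) := by
    rw [im_newtonPoint]
    have e : Kv.im = -t / a := by rw [htdef]; field_simp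
    have e2 : a + Kv.im / n ^ 2 = a - t / (a * n ^ 2) := by rw [e]; field_simp; ring
    have e3 : a * (1 + 3 / (2 * (a * n) ^ 2)) = a + (3 / 2) / (a * n ^ 2) := by field_simp
    rw [← ha, e2, e3]
    have hb1 : |t / (a * n ^ 2)| ≤ (3 / 2) / (a * n ^ 2) := by
      rw [abs_div, abs_of_pos (by positivity : 0 < a * n ^ 2)]
      exact div_le_div_of_nonneg_right (abs_le.mpr ⟨ht1, ht2⟩) (by positivity)
    calc |a - t / (a * n ^ 2)| ≤ |a| + |t / (a * n ^ 2)| := abs_sub _ _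
      _ ≤ a + (3 / 2) / (a * n ^ 2) := by rw [abs_of_pos hv]; linarith
  set δv := (9 / 5) * (μ₀ / (a * n) ^ 2) / n with hδv
  have hδv0 : 0 ≤ δv := by positivity
  have hdropv := energy_drop_closedDisc hd₁
  have hdropv' : 2 * t / n ^ 2 - t ^ 2 / (a ^ 2 * n ^ 4) - 2 * (a * (1 + 3 / (2 * (a * n) ^ 2))) * δv - δv ^ 2 ≤ a ^ 2 - u₁.im ^ 2 := by
    have e1 : 2 * (-(v.im * Kv.im)) / ‖Kv‖ ^ 2 = 2 * t / n ^ 2 := by rw [htdef]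
    have e2 : Kv.im ^ 2 / ‖Kv‖ ^ 4 = t ^ 2 / (a ^ 2 * n ^ 4) := by rw [htdef, ← hn]; field_simp
    have h3 : 2 * |(v - Kv⁻¹).im| * δv ≤ 2 * (a * (1 + 3 / (2 * (a * n) ^ 2))) * δv :=
      mul_le_mul_of_nonneg_right (mul_le_mul_of_nonneg_left hcv two_pos.le) hδv0
    rw [e1, e2] at hdropv
    linarith
  have hV : κ ^ 2 * (2 * t / n ^ 2 - t ^ 2 / (a ^ 2 * n ^ 4) - 2 * (a * (1 + 3 / (2 * (a * n) ^ 2))) * δv - δv ^ 2) ≤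
      (a ^ 2 - u₁.im ^ 2) * κ ^ 2 := by
    rw [mul_comm]; exact mul_le_mul_of_nonneg_right hdropv' (sq_nonneg κ)
  have hkeyv : κ ^ 2 * (2 * t / n ^ 2 - t ^ 2 / (a ^ 2 * n ^ 4) - 2 * (a * (1 + 3 / (2 * (a * n) ^ 2))) * δv - δv ^ 2) =
      2 * t * (a * κ) ^ 2 / (a * n) ^ 2 - (a * κ) ^ 2 * t ^ 2 / (a * n) ^ 4
        - (18 / 5) * μ₀ * (1 + 3 / (2 * (a * n) ^ 2)) * (a * κ) ^ 2 / (a * n) ^ 3 - (81 / 25) * μ₀ ^ 2 * (a * κ) ^ 2 / (a * n) ^ 6 := by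
    rw [hδv]; field_simp; ring
  have hVreal := vbox_real (k := a * κ) (L := a * n) (μ₀ := μ₀) hk hL0 hkL htTv ht2 hTv3 hμ0 hμ
  rw [← hkeyv] at hVreal
  exact hVreal.trans hV

set_option maxHeartbeats 400000 in
/-- §5 (z-part) the upper Newton disc in the box, with the weight `κ²/‖K_z‖²` controlled by `Im v·‖K_z − K_v‖ ≤ e₁ + μ₀r₁ =: P₁`:
`T_z − (2T₁P₁ + (361/100)μ₀/β₀ + (3/200)T₁²/β₀² + 1/1000)/(Im v‖K_v‖) ≤ (Im z² − Im u₂²)·κ²`. -/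
theorem z_part {v z Rv Rz Kv Kz u₂ : ℂ} {M μ₀ T₁ e₁ r₁ β₀ : ℝ} (hμ : μ₀ ≤ 1 / 2)
    (hv : 0 < v.im) (hvz : v.im < z.im) (hsep : v.im ≤ 2 * ‖v - z‖) (hM0 : 0 ≤ M) (hMμ : M ≤ μ₀)
    (hKv : Kv = (v - conj v)⁻¹ + (v - z)⁻¹ + (v - conj z)⁻¹ + Rv) (hKz : Kz = (z - conj z)⁻¹ + (z - v)⁻¹ + (z - conj v)⁻¹ + Rz)
    (hRv : Rv.im ≤ 0) (hRz : Rz.im ≤ 0) (hR : ‖Rz - Rv‖ ≤ M * ‖z - v‖ / (v.im * z.im))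
    (hflv : 30 ≤ v.im * ‖Kv + I / (2 * (v.im : ℂ))‖)
    (hd₂ : ‖u₂ - (z - Kz⁻¹)‖ ≤ (9 / 5) * (μ₀ / (z.im * ‖Kz‖) ^ 2) / ‖Kz‖)
    (hbv : -(v.im * Kv.im) < 3 / 2) (hbz : -(z.im * Kz.im) < 5)
    (hT : 1 - 2 * z.im * pairPull z v ≤ T₁) (hT10 : T₁ ≤ 10)
    (hE : v.im * ‖pairExplicit z v - pairExplicit v z‖ ≤ e₁) (hr : ‖z - v‖ ≤ r₁ * z.im)
    (hβ1 : 1 ≤ β₀) (hβ : β₀ * v.im ≤ z.im) (hPlo : 2 / 3 ≤ e₁ + μ₀ * r₁) (hPhi : e₁ + μ₀ * r₁ ≤ 13 / 2) :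
    (1 - 2 * z.im * pairPull z v) - (2 * T₁ * (e₁ + μ₀ * r₁) + (361 / 100) * μ₀ / β₀ + (3 / 200) * T₁ ^ 2 / β₀ ^ 2 + 1 / 1000) / (v.im * ‖Kv‖) ≤
      (z.im ^ 2 - u₂.im ^ 2) * ‖Kv + I / (2 * (v.im : ℂ))‖ ^ 2 := by
  obtain ⟨hL, hLk2, hkL2, -, -, -⟩ := currencies hv hvz hsep hKv hRv hflv hbv
  have hb : 0 < z.im := hv.trans hvz
  have hμ0 : 0 ≤ μ₀ := hM0.trans hMμ
  set a := v.im with ha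
  set b := z.im with hb'
  set κ := ‖Kv + I / (2 * (a : ℂ))‖ with hκ
  set n := ‖Kv‖ with hn
  set nz := ‖Kz‖ with hnz
  set tz := -(b * Kz.im) with htzdef
  set Tz := 1 - 2 * b * pairPull z v with hTzdef
  set P₁ := e₁ + μ₀ * r₁ with hP₁
  have hL0 : 0 < a * n := by linarith
  -- sign and size at the upper state
  have hpz : pairPull z v < 0 := pairPull_upper_neg hv hvz
  have hbpz : b * pairPull z v < 0 := mul_neg_of_pos_of_neg hb hpz
  have hTz1 : 1 ≤ Tz := by rw [hTzdef]; linarith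
  have hKzim' : Kz.im = -(1 / (2 * b)) + pairPull z v + Rz.im := by rw [hKz, add_im, im_explicit]
  have htzTz : Tz / 2 ≤ tz := by
    have e2 : tz = 1 / 2 - b * pairPull z v - b * Rz.im := by rw [htzdef, hKzim']; field_simp; ring
    rw [e2, hTzdef]
    have := mul_nonpos_iff.mpr (Or.inl ⟨hb.le, hRz⟩)
    linarith
  have htz0 : 0 < tz := by linarith
  have hKzim : Kz.im < 0 := by
    by_contra h
    have : 0 ≤ b * Kz.im := mul_nonneg hb.le (not_lt.mp h)
    linarith
  have hKz0 : Kz ≠ 0 := fun h => by rw [h] at hKzim; simp at hKzim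
  have hnz0 : 0 < nz := norm_pos_iff.mpr hKz0
  have htz5 : tz ≤ 5 := hbz.le
  -- K_z − K_v = (E_z − E_v) + (R_z − R_v), Im v·‖K_z − K_v‖ ≤ P₁
  have hD : Kz - Kv = (pairExplicit z v - pairExplicit v z) + (Rz - Rv) := by
    rw [hKv, hKz]; unfold pairExplicit; ring
  have hRdiff : a * ‖Rz - Rv‖ ≤ μ₀ * r₁ := by
    have h1 : a * ‖Rz - Rv‖ ≤ a * (M * ‖z - v‖ / (a * b)) := mul_le_mul_of_nonneg_left hR hv.le
    have e1 : a * (M * ‖z - v‖ / (a * b)) = M * ‖z - v‖ / b := by field_simp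
    rw [e1] at h1
    have h2 : M * ‖z - v‖ / b ≤ μ₀ * r₁ := by
      rw [div_le_iff₀ hb]
      calc M * ‖z - v‖ ≤ μ₀ * (r₁ * b) := mul_le_mul hMμ hr (norm_nonneg _) hμ0
        _ = μ₀ * r₁ * b := by ring
    exact h1.trans h2
  have hDn : a * ‖Kz - Kv‖ ≤ P₁ := by
    rw [hD, hP₁]
    have h1 : ‖pairExplicit z v - pairExplicit v z + (Rz - Rv)‖ ≤ ‖pairExplicit z v - pairExplicit v z‖ + ‖Rz - Rv‖ := norm_add_le _ _
    have h2 := mul_le_mul_of_nonneg_left h1 hv.le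
    rw [mul_add] at h2
    linarith
  have hm1 : a * n - P₁ ≤ a * nz := by
    have h1 : n - nz ≤ ‖Kz - Kv‖ := by
      have := norm_sub_norm_le Kv Kz; rw [norm_sub_rev] at this; exact this
    have h2 := mul_le_mul_of_nonneg_left h1 hv.le
    rw [mul_sub] at h2
    linarith
  have hm2 : a * nz ≤ a * n + P₁ := by
    have h2 := mul_le_mul_of_nonneg_left (norm_sub_norm_le Kz Kv) hv.le
    rw [mul_sub] at h2
    linarith
  have hLz : β₀ * (a * nz) ≤ b * nz := by
    have := mul_le_mul_of_nonneg_right hβ hnz0.le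
    linarith [this]
  have hmz : 23 ≤ a * nz := by linarith
  have hLz23 : 23 ≤ b * nz := by
    have := mul_le_mul_of_nonneg_right hβ1 (by linarith : (0:ℝ) ≤ a * nz)
    linarith
  -- the z-disc
  have hcz : |(z - Kz⁻¹).im| ≤ b := by
    rw [im_newtonPoint]
    have e : Kz.im = -tz / b := by rw [htzdef]; field_simp
    have h1 : 0 ≤ tz / (b * nz ^ 2) := by positivity
    have h2 : tz / (b * nz ^ 2) ≤ b := by
      rw [div_le_iff₀ (by positivity)]
      have e4 : b * (b * nz ^ 2) = (b * nz) ^ 2 := by ring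
      have h5 : (23:ℝ) ^ 2 ≤ (b * nz) ^ 2 := pow_le_pow_left₀ (by norm_num) hLz23 2
      rw [e4]; linarith
    have e2 : b + Kz.im / nz ^ 2 = b - tz / (b * nz ^ 2) := by rw [e]; field_simp; ring
    rw [← hb', e2, abs_le]
    constructor <;> linarith
  set δz := (9 / 5) * (μ₀ / (b * nz) ^ 2) / nz with hδz
  have hδz0 : 0 ≤ δz := by positivity
  have hdropz := energy_drop_closedDisc hd₂
  have hdropz' : 2 * tz / nz ^ 2 - tz ^ 2 / (b ^ 2 * nz ^ 4) - 2 * b * δz - δz ^ 2 ≤ b ^ 2 - u₂.im ^ 2 := by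
    have e1 : 2 * (-(z.im * Kz.im)) / ‖Kz‖ ^ 2 = 2 * tz / nz ^ 2 := by rw [htzdef]
    have e2 : Kz.im ^ 2 / ‖Kz‖ ^ 4 = tz ^ 2 / (b ^ 2 * nz ^ 4) := by rw [htzdef, ← hnz]; field_simp
    have h3 : 2 * |(z - Kz⁻¹).im| * δz ≤ 2 * b * δz :=
      mul_le_mul_of_nonneg_right (mul_le_mul_of_nonneg_left hcz two_pos.le) hδz0
    rw [e1, e2] at hdropz
    linarith
  have hZ : κ ^ 2 * (2 * tz / nz ^ 2 - tz ^ 2 / (b ^ 2 * nz ^ 4) - 2 * b * δz - δz ^ 2) ≤ (b ^ 2 - u₂.im ^ 2) * κ ^ 2 := by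
    rw [mul_comm]; exact mul_le_mul_of_nonneg_right hdropz' (sq_nonneg κ)
  have hkeyz : κ ^ 2 * (2 * tz / nz ^ 2 - tz ^ 2 / (b ^ 2 * nz ^ 4) - 2 * b * δz - δz ^ 2) =
      (a * κ) ^ 2 / (a * nz) ^ 2 * (2 * tz - tz ^ 2 / (b * nz) ^ 2) - (18 / 5) * μ₀ * ((a * κ) ^ 2 / (a * nz) ^ 2) / (b * nz)
        - (81 / 25) * μ₀ ^ 2 * ((a * κ) ^ 2 / (a * nz) ^ 2) / (b * nz) ^ 4 := by
    rw [hδz]; field_simp; ring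
  have hZreal := zbox_real (k := a * κ) (L := a * n) (m := a * nz) (Lz := b * nz) (tz := tz) (Tz := Tz) (T₁ := T₁) (P₁ := P₁)
    (β₀ := β₀) (μ₀ := μ₀) hL hLk2 hkL2 hm1 hm2 hPlo hPhi hLz hβ1 htzTz htz5 hTz1 hT hT10 hμ0 hμ
  rw [← hkeyz] at hZreal
  exact hZreal.trans hZ

/-- ★★ §5 **THE PERTURBATIVE BOX ON ONE CELL**: GeometricBudget's binders (sub-list) + the box `−Im v·Im K_v < 3/2`, `−Im z·Im K_z < 5`
+ five CELL CONSTANTS bounding the pair's geometry (`0 ≤ S₀ ≤ T_v + T_z − 3`, `T_z ≤ T₁ ≤ 10`, `Im v·‖E_z − E_v‖ ≤ e₁`, `‖z − v‖ ≤ r₁·Im z`,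
`1 ≤ β₀`, `β₀·Im v ≤ Im z`, with `P₁ = e₁ + μ₀r₁ ∈ [2/3, 13/2]`) + the cell criterion `CellOK S₀ T₁ P₁ β₀ μ₀` ⇒ the conclusion of `GeometricBudget 10 μ₀`. -/
theorem budget_box_cell {v z Rv Rz Kv Kz u₁ u₂ : ℂ} {M μ₀ S₀ T₁ e₁ r₁ β₀ : ℝ} (hμ : μ₀ ≤ 1 / 2)
    (hv : 0 < v.im) (hvz : v.im < z.im) (hsep : v.im ≤ 2 * ‖v - z‖) (hM0 : 0 ≤ M) (hMμ : M ≤ μ₀)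
    (hKv : Kv = (v - conj v)⁻¹ + (v - z)⁻¹ + (v - conj z)⁻¹ + Rv) (hKz : Kz = (z - conj z)⁻¹ + (z - v)⁻¹ + (z - conj v)⁻¹ + Rz)
    (hRv : Rv.im ≤ 0) (hRz : Rz.im ≤ 0) (hR : ‖Rz - Rv‖ ≤ M * ‖z - v‖ / (v.im * z.im))
    (hflv : 30 ≤ v.im * ‖Kv + I / (2 * (v.im : ℂ))‖)
    (hd₁ : ‖u₁ - (v - Kv⁻¹)‖ ≤ (9 / 5) * (μ₀ / (v.im * ‖Kv‖) ^ 2) / ‖Kv‖)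
    (hd₂ : ‖u₂ - (z - Kz⁻¹)‖ ≤ (9 / 5) * (μ₀ / (z.im * ‖Kz‖) ^ 2) / ‖Kz‖)
    (hbv : -(v.im * Kv.im) < 3 / 2) (hbz : -(z.im * Kz.im) < 5)
    (hS0 : 0 ≤ S₀) (hS : S₀ ≤ (1 - 2 * v.im * pairPull v z) + (1 - 2 * z.im * pairPull z v) - 3)
    (hT : 1 - 2 * z.im * pairPull z v ≤ T₁) (hT10 : T₁ ≤ 10)
    (hE : v.im * ‖pairExplicit z v - pairExplicit v z‖ ≤ e₁) (hr : ‖z - v‖ ≤ r₁ * z.im)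
    (hβ1 : 1 ≤ β₀) (hβ : β₀ * v.im ≤ z.im) (hPlo : 2 / 3 ≤ e₁ + μ₀ * r₁) (hPhi : e₁ + μ₀ * r₁ ≤ 13 / 2)
    (hOK : CellOK S₀ T₁ (e₁ + μ₀ * r₁) β₀ μ₀) :
    3 - 10 * (1 + μ₀) / (v.im * ‖Kv + I / (2 * (v.im : ℂ))‖) ≤
      ((v.im ^ 2 + z.im ^ 2) - (u₁.im ^ 2 + u₂.im ^ 2)) * ‖Kv + I / (2 * (v.im : ℂ))‖ ^ 2 := by
  have hμ0 : 0 ≤ μ₀ := hM0.trans hMμ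
  obtain ⟨hL, -, -, hk500, -, -⟩ := currencies hv hvz hsep hKv hRv hflv hbv
  have hVfin := v_part hμ0 hμ hv hvz hsep hKv hRv hflv hd₁ hbv
  have hZfin := z_part hμ hv hvz hsep hM0 hMμ hKv hKz hRv hRz hR hflv hd₂ hbv hbz hT hT10 hE hr hβ1 hβ hPlo hPhi
  have hSum := sum_real hflv hL hk500 hVfin hZfin (by linarith) hS0 hμ0 hOK
  have hsplit : ((v.im ^ 2 + z.im ^ 2) - (u₁.im ^ 2 + u₂.im ^ 2)) * ‖Kv + I / (2 * (v.im : ℂ))‖ ^ 2 =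
      (v.im ^ 2 - u₁.im ^ 2) * ‖Kv + I / (2 * (v.im : ℂ))‖ ^ 2 + (z.im ^ 2 - u₂.im ^ 2) * ‖Kv + I / (2 * (v.im : ℂ))‖ ^ 2 := by ring
  rw [hsplit]
  exact hSum

/-! ## §6 The geometric cell cover and K-2 -/

/-- §6 A CELL AT THE POINT `(v, z)`: five constants bounding the pair geometry there and satisfying the cell criterion (purely geometric; no `K`, `R`, `u`). -/
def CellAt (μ₀ : ℝ) (v z : ℂ) : Prop :=
  ∃ S₀ T₁ e₁ r₁ β₀ : ℝ, 0 ≤ S₀ ∧ S₀ ≤ (1 - 2 * v.im * pairPull v z) + (1 - 2 * z.im * pairPull z v) - 3 ∧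
    1 - 2 * z.im * pairPull z v ≤ T₁ ∧ T₁ ≤ 10 ∧ v.im * ‖pairExplicit z v - pairExplicit v z‖ ≤ e₁ ∧ ‖z - v‖ ≤ r₁ * z.im ∧
    1 ≤ β₀ ∧ β₀ * v.im ≤ z.im ∧ 2 / 3 ≤ e₁ + μ₀ * r₁ ∧ e₁ + μ₀ * r₁ ≤ 13 / 2 ∧ CellOK S₀ T₁ (e₁ + μ₀ * r₁) β₀ μ₀

/-- §6 **THE GEOMETRIC CELL COVER**: every admissible pair (`0 < Im v < Im z`, touch `|Re v − Re z| ≤ Im v + Im z`, separation `Im v ≤ 2‖v − z‖`) carries a cell.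
Scale- and translation-invariant: a statement about `(β, d) = (Im z/Im v, (Re z − Re v)/Im v)` on `{β > 1, |d| ≤ 1 + β, d² + (β − 1)² ≥ 1/4}`.  OPEN here. -/
def CellCover (μ₀ : ℝ) : Prop :=
  ∀ v z : ℂ, 0 < v.im → v.im < z.im → |v.re - z.re| ≤ v.im + z.im → v.im ≤ 2 * ‖v - z‖ → CellAt μ₀ v z

/-- ★★ §6 the cell cover discharges the PERTURBATIVE BOX: `CellCover μ₀` ⇒ `GeometricBudgetOn (box) 10 μ₀` (`μ₀ ≤ 1/2`). -/
theorem geometricBudgetOn_box_of_cellCover {μ₀ : ℝ} (hμ : μ₀ ≤ 1 / 2) (h : CellCover μ₀) :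
    GeometricBudgetOn (fun v z Kv Kz => -(v.im * Kv.im) < 3 / 2 ∧ -(z.im * Kz.im) < 5) 10 μ₀ := by
  intro v z Rv Rz Kv Kz u₁ u₂ M hP hv hvz ht hsep hM0 hMμ hKv hKz hRv hRz hR hflv _hflz hd₁ hd₂
  obtain ⟨S₀, T₁, e₁, r₁, β₀, hS0, hS, hT, hT10, hE, hr, hβ1, hβ, hPlo, hPhi, hOK⟩ := h v z hv hvz ht hsep
  exact budget_box_cell hμ hv hvz hsep hM0 hMμ hKv hKz hRv hRz hR hflv hd₁ hd₂ hP.1 hP.2 hS0 hS hT hT10 hE hr hβ1 hβ hPlo hPhi hOK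

/-- ★★★ §6 **`CellCover μ₀ → GeometricBudget 10 μ₀`** (`μ₀ ≤ 1/2`; cases (A), (B1) = images J, L; the box = this file). -/
theorem geometricBudget_ten_of_cellCover {μ₀ : ℝ} (hμ : μ₀ ≤ 1 / 2) (h : CellCover μ₀) : GeometricBudget 10 μ₀ :=
  geometricBudget_ten_of_box hμ (geometricBudgetOn_box_of_cellCover hμ h)

/-- ★★★ §6 **K-2 FROM THE GEOMETRIC CELL COVER**: `CellCover (1/2) → PerturbativeDropLightPairQ 10 (1/2)` (image G's `perturbativeDropLightPairQ_ten_half`). -/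
theorem k2_of_cellCover (h : CellCover (1 / 2)) : PerturbativeDropLightPairQ 10 (1 / 2) :=
  perturbativeDropLightPairQ_ten_half (geometricBudget_ten_of_cellCover (by norm_num) h)

end RhW08.BudgetBox
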